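import Literature.Analysis.FluidPDE.LocalTypeISlabProfile
import Literature.Analysis.FluidPDE.ChaeAsymptoticallySelfSimilarEndgame
import Literature.Analysis.FluidPDE.ClassicalTopPointCubic
import Summits.NavierStokesRegularity.NavierStokesRegularity.Theorems.RecurrentProfilesRecurrentReductionOrbit
import HarnessLib

/-!
# Crux `ForcedSymmetry` (stmt-NavierStokesRegularity-4052), line `recurrent-closing`, stub 3a
# `stub_satelliteExclusion`: regularity of a final-slice point with vanishing cubic functional in the class

Support file (theorems only, `--supports stmt-NavierStokesRegularity-4052`; the same stub is stub 1 of crux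
stmt-NavierStokesRegularity-8561's line `birth`).  Lead c6.

Albritton–Barker's local Type-I class on the backward slab `ℝ³ × (−∞, 0)` is the class every profile of the stub lives
in: `(w, q)` suitable weak on the slab, weak spatial gradient `H`, `𝐈(ℝ³ × ℝ₋) < ∞`.  This file proves the regularity
criterion the in-class version of Chae–Wolf's satellite exclusion needs at the TOP points `(0, x₀)` of the slab:

* `not_isBackwardSingularPoint_origin_of_tendsto_cknC` — if `C(r; 0) = r⁻² ∫∫_{Q(0,r)} |w|³ → 0` as `r → 0⁺`, the
  space–time origin is NOT a backward singular point.  Proof: were it singular, the A–B packaging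
  (`isLocalTypeISingularPoint_of_slabProfile`) puts `(w, q − [q]_{B(0,1)})` in the class `IsSuitableWeakSolutionInBall 1 0`;
  the pressure-decay iteration (`exists_cknC_add_cknD_le_of_tendsto_cknC`, Seregin–Šverák) makes `C + D` small at one
  scale `r ≤ 1`; zooming `Q(0, r)` to the unit ball, the ε-regularity lemma over the class
  (`epsilonRegularity_holder_of_inBall`, ESS 2003 Lemma 2.2) bounds the zoomed field essentially on `Q(0, 1/2)` —
  contradicting the singular origin of the zoom (`isBackwardSingularPoint_zoom`).
* `not_isBackwardSingularPoint_of_tendsto_cknC` — the same at every top point `(0, x₀)` (translate the profile; the class,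
  `𝐈`, `C` and backward singular points are translation covariant: `zoom_isSuitableWeakSolutionOn`, `typeIBound_nsZoom`,
  `cknC_nsZoom`, `eLpNorm_top_nsZoom` with factor `1`).

No classical smoothness, no Type-I time rate and no self-similarity is used here: this is the "[gus]" step
("`lim_{r→0} r⁻² ∫_{Q(z₀,r)} |u|³ = 0` … then `z₀` is a regular point", Chae–Wolf 2017, end of Step 4) inside the class.

References: D. Chae, J. Wolf, Comm. PDE 42 (2017) = arXiv:1610.09464, proof of Thm 1.1, Step 4 [ChaeWolf2017RemovingDSS];
S. Gustafson, K. Kang, T.-P. Tsai, CMP 273 (2007), Thm 1.1 [GustafsonKangTsai2007]; D. Albritton, T. Barker, JMFM 21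
(2019), Def. 2.1, §3 [AlbrittonBarker2019]; L. Escauriaza, G. Seregin, V. Šverák, Russ. Math. Surveys 58 (2003),
Lemma 2.2 [EscauriazaSereginSverak2003].
-/

noncomputable section

-- the summit and its single sub-problem share the name (CONVENTIONS §1), as in every Theorems file
set_option linter.dupNamespace false

open MeasureTheory Set Function Metric Filter Topology
open scoped ENNReal NNReal
open Literature.Analysis.FluidPDE

namespace Summit.NavierStokesRegularity.NavierStokesRegularity.Theorems.SymmetryModuliCountForcedSymmetry

/-! ### The origin -/

/-- **Vanishing cubic functional at the origin ⇒ the origin is regular, in Albritton–Barker's slab class.**  For a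
suitable weak solution `(w, q)` on `(EuclideanSpace ℝ (Fin 3)) × (−∞,0)` with weak gradient `H` and `𝐈((EuclideanSpace ℝ (Fin 3)) × ℝ₋) < ∞`: if
`C(r; 0) = r⁻² ∫∫_{Q(0,r)} |w|³ → 0` as `r → 0⁺`, then the space–time origin is not a backward singular point
(pressure-decay smallness of `C + D` at one scale, zoom to the unit ball, ε-regularity over the class).
[cite: ChaeWolf2017RemovingDSS, proof of Thm 1.1, Step 4 (arXiv p. 7); GustafsonKangTsai2007 Thm 1.1; AlbrittonBarker2019 Def. 2.1] -/
theorem not_isBackwardSingularPoint_origin_of_tendsto_cknC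
    {w : ℝ → (EuclideanSpace ℝ (Fin 3)) → (EuclideanSpace ℝ (Fin 3))} {q : ℝ → (EuclideanSpace ℝ (Fin 3)) → ℝ} {H : ℝ → (EuclideanSpace ℝ (Fin 3)) → (EuclideanSpace ℝ (Fin 3)) →L[ℝ] (EuclideanSpace ℝ (Fin 3))}
    (hsw : IsSuitableWeakSolutionOn (slab (EuclideanSpace ℝ (Fin 3)) (Iio (0 : ℝ)) isOpen_Iio) 1 0 w q)
    (hwg : HasWeakSpatialGradientOn (slab (EuclideanSpace ℝ (Fin 3)) (Iio (0 : ℝ)) isOpen_Iio) w H)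
    (hI : typeIBound (Iio (0 : ℝ) ×ˢ (univ : Set (EuclideanSpace ℝ (Fin 3)))) w q H < ⊤)
    (hlim : Tendsto (fun r => cknC r (0 : ℝ × (EuclideanSpace ℝ (Fin 3))) w) (𝓝[>] 0) (𝓝 0)) :
    ¬ IsBackwardSingularPoint w 0 := by
  intro hsing
  -- A–B packaging at the origin: the class `IsSuitableWeakSolutionInBall 1 0` with the mean-free pressure
  set q' : ℝ → (EuclideanSpace ℝ (Fin 3)) → ℝ := fun t x => q t x - ⨍ y in ball (0 : (EuclideanSpace ℝ (Fin 3))) 1, q t y with hq'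
  have hLT := isLocalTypeISingularPoint_of_slabProfile hsw hwg hI hsing
  have hball : IsSuitableWeakSolutionInBall 1 0 w q' := hLT.2.1
  obtain ⟨ε₀, c₀, hε₀, _hc₀, Hε⟩ := epsilonRegularity_holder_of_inBall
  -- one-scale smallness of `C + D`
  have hdist : IsDistributionalNSSolutionOn (parabolicCylinderOpens 1 (0 : ℝ × (EuclideanSpace ℝ (Fin 3)))) 1 0 w q' :=
    hball.1.distributional
  have hD : cknD 1 (0 : ℝ × (EuclideanSpace ℝ (Fin 3))) q' ≠ ∞ := cknD_ne_top_of_memLp one_pos hball.2.2.2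
  have hδ : (0 : ℝ≥0∞) < ENNReal.ofReal ε₀ / 2 :=
    ENNReal.div_pos (ENNReal.ofReal_pos.2 hε₀).ne' (by norm_num)
  obtain ⟨r, ⟨hr, hr1⟩, hsmall⟩ := exists_cknC_add_cknD_le_of_tendsto_cknC hdist one_pos
    (by simp only [coe_parabolicCylinderOpens]; exact subset_rfl) hD hlim hδ
  have hlt : cknC r (0 : ℝ × (EuclideanSpace ℝ (Fin 3))) w + cknD r (0 : ℝ × (EuclideanSpace ℝ (Fin 3))) q' < ENNReal.ofReal ε₀ :=
    hsmall.trans_lt (ENNReal.half_lt_self (ENNReal.ofReal_pos.2 hε₀).ne' ENNReal.ofReal_ne_top)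
  have hballr : IsSuitableWeakSolutionInBall r 0 w q' := hball.of_le_radius hr hr1
  -- zoom `Q(0, r)` to the unit ball
  have hzoom := hballr.zoom hr
  simp only [Prod.fst_zero, Prod.snd_zero] at hzoom
  set U : ℝ → (EuclideanSpace ℝ (Fin 3)) → (EuclideanSpace ℝ (Fin 3)) := r • stPull (r ^ 2) r (0 : ℝ) (0 : (EuclideanSpace ℝ (Fin 3))) w with hU
  set P : ℝ → (EuclideanSpace ℝ (Fin 3)) → ℝ := r ^ 2 • stPull (r ^ 2) r (0 : ℝ) (0 : (EuclideanSpace ℝ (Fin 3))) q' with hP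
  have hmeasU : AEMeasurable (fun z : ℝ × (EuclideanSpace ℝ (Fin 3)) => ‖U z.1 z.2‖ₑ ^ 3)
      (volume.restrict (parabolicCylinder 1 (0 : ℝ × (EuclideanSpace ℝ (Fin 3))))) := by
    have h1 : AEStronglyMeasurable (uncurry U) (volume.restrict (parabolicCylinder 1 (0 : ℝ × (EuclideanSpace ℝ (Fin 3))))) :=
      hzoom.1.distributional.1.aestronglyMeasurable
    exact h1.enorm.pow_const 3
  have hsmall' : ∫⁻ z in parabolicCylinder 1 ((0 : ℝ), (0 : (EuclideanSpace ℝ (Fin 3)))),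
      (‖U z.1 z.2‖ₑ ^ 3 + ‖P z.1 z.2‖ₑ ^ (3 / 2 : ℝ)) < ENNReal.ofReal ε₀ := by
    have e : ((0 : ℝ), (0 : (EuclideanSpace ℝ (Fin 3)))) = (0 : ℝ × (EuclideanSpace ℝ (Fin 3))) := rfl
    have hC := lintegral_cube_zoom hr (0 : ℝ × (EuclideanSpace ℝ (Fin 3))) w
    have hDz := lintegral_pressure_zoom hr (0 : ℝ × (EuclideanSpace ℝ (Fin 3))) q'
    simp only [Prod.fst_zero, Prod.snd_zero] at hC hDz
    rw [e, lintegral_add_left' hmeasU, hU, hP, hC, hDz]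
    exact hlt
  obtain ⟨V, K, α, _hα, _hH, hae, hbd⟩ := Hε U P hzoom hsmall'
  -- the zoomed field is essentially bounded by `c₀` on `Q(0, 1/2)`
  have hbound : eLpNorm (uncurry U) ∞
      (volume.restrict (parabolicCylinder (1 / 2) ((0 : ℝ), (0 : (EuclideanSpace ℝ (Fin 3)))))) ≤ ENNReal.ofReal c₀ := by
    rw [eLpNorm_exponent_top]
    refine eLpNormEssSup_le_of_ae_bound ?_
    filter_upwards [hae, ae_restrict_mem (isOpen_parabolicCylinder _ _).measurableSet] with z hz hmem
    rw [hz]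
    exact (hbd z (subset_closure hmem)).le
  -- but the origin is singular for the zoom
  have hsingU : IsBackwardSingularPoint U 0 := by
    rw [hU]
    exact isBackwardSingularPoint_zoom hsing hr
  have htop := hsingU (1 / 2) (by norm_num)
  have e : ((0 : ℝ), (0 : (EuclideanSpace ℝ (Fin 3)))) = (0 : ℝ × (EuclideanSpace ℝ (Fin 3))) := rfl
  rw [e] at hbound
  rw [htop] at hbound
  exact ENNReal.ofReal_ne_top (top_le_iff.1 hbound)

/-! ### Any top point, by translation -/

/-- Translating in space at the final time maps the open backward slab onto itself (`Opens` form). [folklore] -/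
theorem stPreimage_one_slab_eq (x₀ : (EuclideanSpace ℝ (Fin 3))) :
    stPreimage ((1 : ℝ) ^ 2) 1 0 x₀ (slab (EuclideanSpace ℝ (Fin 3)) (Iio (0 : ℝ)) isOpen_Iio) = slab (EuclideanSpace ℝ (Fin 3)) (Iio (0 : ℝ)) isOpen_Iio := by
  apply TopologicalSpace.Opens.ext
  rw [coe_stPreimage, coe_slab]
  ext ⟨t, x⟩
  simp only [mem_preimage, stAffine_apply, mem_prod, mem_Iio, mem_univ, and_true, one_pow, one_mul, zero_add]

/-- Translating in space at the final time maps `(EuclideanSpace ℝ (Fin 3)) × ℝ₋` onto itself (set form). [folklore] -/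
theorem stAffine_one_preimage_lowerHalf' (x₀ : (EuclideanSpace ℝ (Fin 3))) :
    stAffine ((1 : ℝ) ^ 2) 1 0 x₀ ⁻¹' (Iio (0 : ℝ) ×ˢ (univ : Set (EuclideanSpace ℝ (Fin 3)))) = Iio (0 : ℝ) ×ˢ univ := by
  ext ⟨t, x⟩
  simp only [mem_preimage, stAffine_apply, mem_prod, mem_Iio, mem_univ, and_true, one_pow, one_mul, zero_add]

/-- **Vanishing cubic functional at a top point ⇒ the point is regular, in Albritton–Barker's slab class.**  For a
suitable weak solution `(w, q)` on `(EuclideanSpace ℝ (Fin 3)) × (−∞,0)` with weak gradient `H` and `𝐈((EuclideanSpace ℝ (Fin 3)) × ℝ₋) < ∞`, and a final-slice point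
`(0, x₀)`: if `C(r; (0, x₀)) → 0` as `r → 0⁺`, then `(0, x₀)` is not a backward singular point (the origin case applied
to the translated profile `w(t, x₀ + x)`, which lies in the same class with the same `𝐈`).
[cite: ChaeWolf2017RemovingDSS, proof of Thm 1.1, Step 4 (arXiv p. 7); AlbrittonBarker2019, §3] -/
theorem not_isBackwardSingularPoint_of_tendsto_cknC
    {w : ℝ → (EuclideanSpace ℝ (Fin 3)) → (EuclideanSpace ℝ (Fin 3))} {q : ℝ → (EuclideanSpace ℝ (Fin 3)) → ℝ} {H : ℝ → (EuclideanSpace ℝ (Fin 3)) → (EuclideanSpace ℝ (Fin 3)) →L[ℝ] (EuclideanSpace ℝ (Fin 3))}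
    (hsw : IsSuitableWeakSolutionOn (slab (EuclideanSpace ℝ (Fin 3)) (Iio (0 : ℝ)) isOpen_Iio) 1 0 w q)
    (hwg : HasWeakSpatialGradientOn (slab (EuclideanSpace ℝ (Fin 3)) (Iio (0 : ℝ)) isOpen_Iio) w H)
    (hI : typeIBound (Iio (0 : ℝ) ×ˢ (univ : Set (EuclideanSpace ℝ (Fin 3)))) w q H < ⊤) (x₀ : (EuclideanSpace ℝ (Fin 3)))
    (hlim : Tendsto (fun r => cknC r ((0 : ℝ), x₀) w) (𝓝[>] 0) (𝓝 0)) :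
    ¬ IsBackwardSingularPoint w ((0 : ℝ), x₀) := by
  -- the translated profile
  set w₁ : ℝ → (EuclideanSpace ℝ (Fin 3)) → (EuclideanSpace ℝ (Fin 3)) := (1 : ℝ) • stPull ((1 : ℝ) ^ 2) 1 0 x₀ w with hw₁
  set q₁ : ℝ → (EuclideanSpace ℝ (Fin 3)) → ℝ := (1 : ℝ) ^ 2 • stPull ((1 : ℝ) ^ 2) 1 0 x₀ q with hq₁
  set H₁ : ℝ → (EuclideanSpace ℝ (Fin 3)) → (EuclideanSpace ℝ (Fin 3)) →L[ℝ] (EuclideanSpace ℝ (Fin 3)) := (1 : ℝ) ^ 2 • stPull ((1 : ℝ) ^ 2) 1 0 x₀ H with hH₁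
  have hsw₁ : IsSuitableWeakSolutionOn (slab (EuclideanSpace ℝ (Fin 3)) (Iio (0 : ℝ)) isOpen_Iio) 1 0 w₁ q₁ := by
    have h := zoom_isSuitableWeakSolutionOn hsw one_pos 0 x₀
    rwa [stPreimage_one_slab_eq x₀] at h
  have hwg₁ : HasWeakSpatialGradientOn (slab (EuclideanSpace ℝ (Fin 3)) (Iio (0 : ℝ)) isOpen_Iio) w₁ H₁ := by
    have h := zoom_hasWeakSpatialGradientOn hwg one_pos 0 x₀
    rwa [stPreimage_one_slab_eq x₀] at h
  have hI₁ : typeIBound (Iio (0 : ℝ) ×ˢ (univ : Set (EuclideanSpace ℝ (Fin 3)))) w₁ q₁ H₁ < ⊤ := by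
    have h := typeIBound_nsZoom one_pos 0 x₀ (Iio (0 : ℝ) ×ˢ (univ : Set (EuclideanSpace ℝ (Fin 3)))) w q H
    rw [stAffine_one_preimage_lowerHalf' x₀] at h
    rw [hw₁, hq₁, hH₁, h]
    exact hI
  have h0 : stAffine ((1 : ℝ) ^ 2) 1 0 x₀ (0 : ℝ × (EuclideanSpace ℝ (Fin 3))) = ((0 : ℝ), x₀) := by
    simp [stAffine]
  have hlim₁ : Tendsto (fun r => cknC r (0 : ℝ × (EuclideanSpace ℝ (Fin 3))) w₁) (𝓝[>] 0) (𝓝 0) := by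
    refine hlim.congr' ?_
    filter_upwards [self_mem_nhdsWithin] with r hr
    rw [hw₁, cknC_nsZoom one_pos hr 0 x₀ 0 w, one_mul, h0]
  have hreg := not_isBackwardSingularPoint_origin_of_tendsto_cknC hsw₁ hwg₁ hI₁ hlim₁
  intro hsing
  apply hreg
  intro r hr
  rw [hw₁, eLpNorm_top_nsZoom one_pos 0 x₀ r 0 w, one_mul, h0, hsing r hr, ENNReal.ofReal_one, one_mul]

end Summit.NavierStokesRegularity.NavierStokesRegularity.Theorems.SymmetryModuliCountForcedSymmetry

end
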